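import Mathlib
import Summits.NavierStokesRegularity.NavierStokesRegularity.Theorems.EulerZoomLiouvillePowerGaugeEulerLiouvilleLastExitLateReturns
import Summits.NavierStokesRegularity.NavierStokesRegularity.Theorems.EulerZoomLiouvillePowerGaugeEulerLiouvilleLastExitStayersReturn
import Summits.NavierStokesRegularity.NavierStokesRegularity.Theorems.EulerZoomLiouvillePowerGaugeEulerLiouvilleDriftClockInvariantMember
import HarnessLib

/-!
# «SPIKES OR HOVERING» — THE T-D MEMBER: no far hovering + no vortical Bernoulli spikes above one vortical level ⇒ the local power clock ⇒ trivial
# (crux `EulerZoomLiouville.PowerGaugeEulerLiouville` = stmt-NavierStokesRegularity-19832; line `last_exit` of ns-idea-11 g8 assembled at Theorems level; width seat ns-ezl-w3 g6)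

Route №10 `EulerZoomLiouville` (NavierStokesRegularity), crux E.  The line `Cruxes/PowerGaugeEulerLiouville/Lines/last_exit.lean` (LINE g8-2) composes its three
provable stubs LE1 (`LastExit.stayersReturn`, ns-ezl-w1 g6), LE2a (`LastExit.cofinalReturnerBounded`), LE2b (`LastExit.lateReturnsVanish`) — all tree
theorems now — into `Sig.memberSpikesOrHovering`.  A Cruxes line cannot be imported by Theorems files, so this file RE-ASSEMBLES the composition at
Theorems level, BY NAME, and pushes it to member level for the LEAD:

* `LastExit.rpow_threshold` — `C R^θ ≤ k R^e` beyond a radius (`θ < e`, `k > 0`);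
* `LastExit.localPowerClock_of_spikesOrHovering` — **= `Sig.memberSpikesOrHovering` VERBATIM with `NoFarHovering` / `NoVorticalSpikes` / `LocalPowerClock` unfolded**:
  `(V,P′)` a `C²` profile, NO FAR HOVERING above `h` (floor `w₀` beyond `R₁`), NO VORTICAL SPIKES above `h` (`ℋ ≤ h + C R^θ` at vortical points of `{ℋ > h} ∩ B̄(0,2R)`,
  `θ < 2+ρ`), one vortical `x₀` with `ℋ(x₀) > h` ⇒ the v88 LOCAL POWER CLOCK (= `HasResidenceClock` alternative 6 verbatim).  Proof = the line's `member_of`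
  verbatim: `T = c′R^{2+ρ}`, `D = T/2`, `m = h + C R^θ`; LE1 sends every stayer of `[0,T]` back into `B(0,R₁)` after time `T/2`; LE2b (`ε = ½`) makes those late
  returners at most half of the ball for `T/2 ≥ S₀`;
* `Loc.selfSimilar_ae_eq_zero_of_spikesOrHoveringC2_profile` / `Past.selfSimilar_ae_eq_zero_of_spikesOrHoveringC2_profile_past` — THE MEMBERS (crux hypotheses
  verbatim, `0 < ρ ≤ ½`, centred / past-exact about `(T, x₀)`, `V ∈ C²`): binder
  `hB : ∀ P′, IsSelfSimilarEulerProfile γ 0 V P′ → ∃ x₀, curl V x₀ ≠ 0 ∧ ∃ h < ℋ_{P′}(x₀), (∃ w₀ R₁, 0 < w₀ ∧ «no far hovering above h») ∧ (∃ C θ, θ < 2+ρ ∧ «no vortical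
  spikes above h»)` ⇒ trivial (classical pressure by `WeakToClassical.exists_isSelfSimilarEulerProfile_of_contDiff` / `Past.exists_isSelfSimilarEulerProfile`,
  then `NeedleRace.selfSimilar_ae_eq_zero_of_localPowerClockC2[_past]`).  RESIDUE-MEMO-19832-g13 §3 T-D, WITHOUT the band deficit and without T-C.

WHAT THIS IS NOT: not NS regularity, not the crux E — a member-level alternative on the MODEL lattice; the line's faces `stub_hoverFace` (XL = T-E) and
`stub_spikeFace` (L) stay OPEN; DENT on the three registered stubs of `birth.lean` = 0; `--supports` stmt-19832; 19832 OPEN.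
[folklore; ConstantinIgnatovaVicol2026Putative §3.4–§3.5]
-/

noncomputable section

-- flat `Theorems/<Route><Decl>…` files of one crux share the namespace of the crux (tree convention: `Summit.<S>.<S>.…`)
set_option linter.dupNamespace false

open Set Filter Topology Metric MeasureTheory Function
open scoped RealInnerProductSpace ENNReal NNReal

namespace Summit.NavierStokesRegularity.NavierStokesRegularity.Theorems.PowerGaugeEulerLiouville

open Literature.Analysis Literature.Analysis.FluidPDE

namespace LastExit

/-- Power thresholds: for `k > 0` and `θ < e` there is `R₀ ≥ 1` with `C R^θ ≤ k R^e` for `R ≥ R₀`. [folklore] -/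
theorem rpow_threshold {k θ e : ℝ} (hk : 0 < k) (hθe : θ < e) (C : ℝ) :
    ∃ R₀ : ℝ, 1 ≤ R₀ ∧ ∀ R : ℝ, R₀ ≤ R → C * R ^ θ ≤ k * R ^ e := by
  -- adapted from the line's `exists_threshold` (ns-idea-11 g8)
  have hd : 0 < e - θ := sub_pos.mpr hθe
  refine ⟨max 1 ((max (C / k) 0) ^ (1 / (e - θ))), le_max_left _ _, fun R hR => ?_⟩
  have hR1 : 1 ≤ R := le_trans (le_max_left _ _) hR
  have hR0 : 0 < R := lt_of_lt_of_le one_pos hR1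
  have hbase : 0 ≤ max (C / k) 0 := le_max_right _ _
  have hpow : C / k ≤ R ^ (e - θ) := by
    have h1 : (max (C / k) 0) ^ (1 / (e - θ)) ≤ R := le_trans (le_max_right _ _) hR
    have h2 : ((max (C / k) 0) ^ (1 / (e - θ))) ^ (e - θ) ≤ R ^ (e - θ) :=
      Real.rpow_le_rpow (Real.rpow_nonneg hbase _) h1 hd.le
    have h3 : ((max (C / k) 0) ^ (1 / (e - θ))) ^ (e - θ) = max (C / k) 0 := by
      rw [one_div, Real.rpow_inv_rpow hbase hd.ne']
    rw [h3] at h2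
    exact le_trans (le_max_left _ _) h2
  have hCk : C ≤ k * R ^ (e - θ) := by
    have := mul_le_mul_of_nonneg_left hpow hk.le
    rwa [mul_div_cancel₀ _ hk.ne'] at this
  have hsplit : R ^ e = R ^ (e - θ) * R ^ θ := by
    rw [← Real.rpow_add hR0]; ring_nf
  rw [hsplit, ← mul_assoc]
  exact mul_le_mul_of_nonneg_right hCk (Real.rpow_nonneg hR0.le _)

/-- **«SPIKES OR HOVERING» ⇒ THE LOCAL POWER CLOCK** (= the line's `Sig.memberSpikesOrHovering` with `NoFarHovering`, `NoVorticalSpikes`, `LocalPowerClock`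
unfolded).  `(V, P′)` a `C²` profile at rate `γ = 1/(2+ρ)`, `0 < ρ ≤ ½`; no far hovering above `h` (floor `w₀ > 0` beyond `R₁`); no vortical spikes above `h`
(`ℋ ≤ h + C R^θ` on the vortical points of `{ℋ > h} ∩ B̄(0,2R)`, `R ≥ 1`, with `θ < 2+ρ`); one vortical `x₀` with `ℋ(x₀) > h`.  Then for every `c′ > 0` some ball
(centre `x₀`) has at most half of its labels staying in `B̄(0,2R)` for backward similarity time `c′R^{2+ρ}` along every cut-off flow, all large `R`.  Proof = the
line's `member_of` (LE1 `LastExit.stayersReturn` + LE2b `LastExit.lateReturnsVanish` at `ε = ½`). [folklore; ConstantinIgnatovaVicol2026Putative §3.5] -/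
theorem localPowerClock_of_spikesOrHovering :
    ∀ ρ : ℝ, 0 < ρ → ρ ≤ 1 / 2 →
    ∀ (V : EuclideanSpace ℝ (Fin 3) → EuclideanSpace ℝ (Fin 3)) (P' : EuclideanSpace ℝ (Fin 3) → ℝ), ContDiff ℝ 2 V →
      IsSelfSimilarEulerProfile (1 / (2 + ρ)) 0 V P' →
      ∀ (h w₀ R₁ : ℝ), 0 < w₀ →
        (∀ y : EuclideanSpace ℝ (Fin 3), R₁ ≤ ‖y‖ →
          h < selfSimilarBernoulli (1 / (2 + ρ)) 0 V P' y → curl V y ≠ 0 →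
            w₀ ≤ ‖selfSimilarTransport (1 / (2 + ρ)) 0 V y‖) →
      ∀ (C θ : ℝ), θ < 2 + ρ →
        (∀ R : ℝ, 1 ≤ R → ∀ z : EuclideanSpace ℝ (Fin 3), ‖z‖ ≤ 2 * R → curl V z ≠ 0 →
          h < selfSimilarBernoulli (1 / (2 + ρ)) 0 V P' z →
            selfSimilarBernoulli (1 / (2 + ρ)) 0 V P' z ≤ h + C * R ^ θ) →
      ∀ x₀ : EuclideanSpace ℝ (Fin 3), curl V x₀ ≠ 0 →
        h < selfSimilarBernoulli (1 / (2 + ρ)) 0 V P' x₀ →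
        ∀ c' : ℝ, 0 < c' → ∃ x₁ : EuclideanSpace ℝ (Fin 3), ∃ r : ℝ, 0 < r ∧ ∃ R₀ : ℝ, ∀ R : ℝ, R₀ ≤ R →
          ∀ (V' : EuclideanSpace ℝ (Fin 3) → EuclideanSpace ℝ (Fin 3)) (K Rbig : ℝ), ContDiff ℝ 2 V' →
            (∀ y, ‖fderiv ℝ V' y‖ ≤ K) → 2 * R < Rbig →
            (∀ w ∈ Metric.ball (0 : EuclideanSpace ℝ (Fin 3)) Rbig, V' w = V w) →
            (volume (Metric.ball x₁ r ∩ {y | ∀ σ ∈ Set.Icc 0 (c' * R ^ (2 + ρ)),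
              ‖ODE.evolutionMap (fun _ : ℝ => selfSimilarTransport (1 / (2 + ρ)) 0 V') 0 (-σ) y‖ ≤ 2 * R})).toReal ≤
              (volume (Metric.ball x₁ r)).toReal / 2 := by
  -- adapted from the line's `member_of` (ns-idea-11 g8, `Lines/last_exit.lean`), with the stubs replaced by the tree theorems
  intro ρ hρ hρh V P' hV hprof h w₀ R₁ hw₀ hNFH C θ hθe hNS x₀ hx₀ hhx₀
  obtain ⟨r, hr, hball, hlate⟩ := lateReturnsVanish ρ hρ hρh V P' hV hprof h w₀ R₁ hw₀ hNFH x₀ hx₀ hhx₀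
  obtain ⟨S₀, hS₀⟩ := hlate (1 / 2) (by norm_num)
  intro c' hc'
  have hγ : 0 < 1 - 2 * (1 / (2 + ρ)) := by
    have h2ρ : 0 < 2 + ρ := by linarith
    rw [sub_pos, ← div_eq_mul_one_div, div_lt_one h2ρ]; linarith
  have hk₁ : 0 < (1 - 2 * (1 / (2 + ρ))) * w₀ ^ 2 * (c' / 2) := by positivity
  have hk₂ : 0 < c' / 2 := by positivity
  obtain ⟨A₁, hA₁, hth₁⟩ := rpow_threshold hk₁ hθe C
  obtain ⟨A₂, hA₂, hth₂⟩ := rpow_threshold hk₂ (by linarith : (0 : ℝ) < 2 + ρ) S₀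
  refine ⟨x₀, r, hr, max A₁ A₂, fun R hR V' K Rbig hV' hK hRbig hagree => ?_⟩
  have hR₁' : A₁ ≤ R := le_trans (le_max_left _ _) hR
  have hR₂' : A₂ ≤ R := le_trans (le_max_right _ _) hR
  have hR1 : 1 ≤ R := le_trans hA₁ hR₁'
  have hRpos : 0 < R := lt_of_lt_of_le one_pos hR1
  set T : ℝ := c' * R ^ (2 + ρ) with hT
  have hTnn : 0 ≤ T := by positivity
  have hD : (h + C * R ^ θ) - h ≤ (1 - 2 * (1 / (2 + ρ))) * w₀ ^ 2 * (T / 2) := by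
    have := hth₁ R hR₁'
    have e1 : (1 - 2 * (1 / (2 + ρ))) * w₀ ^ 2 * (c' / 2) * R ^ (2 + ρ) =
        (1 - 2 * (1 / (2 + ρ))) * w₀ ^ 2 * (T / 2) := by rw [hT]; ring
    linarith [this, e1]
  have hS : S₀ ≤ T / 2 := by
    have h0 := hth₂ R hR₂'
    rw [Real.rpow_zero, mul_one] at h0
    have e1 : c' / 2 * R ^ (2 + ρ) = T / 2 := by rw [hT]; ring
    rw [← e1]; exact h0
  -- the staying labels return late
  have hsub :
      Metric.ball x₀ r ∩ {y | ∀ σ ∈ Set.Icc 0 (c' * R ^ (2 + ρ)),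
          ‖ODE.evolutionMap (fun _ : ℝ => selfSimilarTransport (1 / (2 + ρ)) 0 V') 0 (-σ) y‖ ≤ 2 * R} ⊆
      Metric.ball x₀ r ∩ {y | ∃ σ : ℝ, T / 2 ≤ σ ∧
          (∀ σ' ∈ Set.Icc 0 σ, ‖ODE.evolutionMap (fun _ : ℝ => selfSimilarTransport (1 / (2 + ρ)) 0 V') 0 (-σ') y‖ ≤ 2 * R) ∧
          ‖ODE.evolutionMap (fun _ : ℝ => selfSimilarTransport (1 / (2 + ρ)) 0 V') 0 (-σ) y‖ < R₁} := by
    rintro y ⟨hyB, hstay⟩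
    refine ⟨hyB, ?_⟩
    obtain ⟨hcy, hhy⟩ := hball hyB
    have hstay' : ∀ σ ∈ Set.Icc 0 T,
        ‖ODE.evolutionMap (fun _ : ℝ => selfSimilarTransport (1 / (2 + ρ)) 0 V') 0 (-σ) y‖ ≤ 2 * R := by
      simpa [hT] using hstay
    obtain ⟨σ, hσ, hσR₁⟩ :=
      stayersReturn ρ hρ hρh V P' hV hprof h w₀ R₁ hw₀ hNFH R (h + C * R ^ θ) (T / 2)
        (fun z hz hcz hhz => hNS R hR1 z hz hcz hhz) hD (by positivity)
        V' K Rbig hV' hK hRbig hagree y T hcy hhy hstay' (T / 2) (by positivity) (by linarith)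
    refine ⟨σ, hσ.1, fun σ' hσ' => hstay' σ' ⟨hσ'.1, ?_⟩, hσR₁⟩
    have : σ ≤ T / 2 + T / 2 := hσ.2
    linarith [hσ'.2]
  -- measure bookkeeping
  have hfin : volume (Metric.ball x₀ r ∩ {y | ∃ σ : ℝ, T / 2 ≤ σ ∧
          (∀ σ' ∈ Set.Icc 0 σ, ‖ODE.evolutionMap (fun _ : ℝ => selfSimilarTransport (1 / (2 + ρ)) 0 V') 0 (-σ') y‖ ≤ 2 * R) ∧
          ‖ODE.evolutionMap (fun _ : ℝ => selfSimilarTransport (1 / (2 + ρ)) 0 V') 0 (-σ) y‖ < R₁}) ≠ ⊤ :=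
    (lt_of_le_of_lt (measure_mono Set.inter_subset_left) measure_ball_lt_top).ne
  have hmono := ENNReal.toReal_mono hfin (measure_mono hsub)
  have hhalf := hS₀ (T / 2) R hS V' K Rbig hV' hK hRbig hagree
  calc (volume (Metric.ball x₀ r ∩ {y | ∀ σ ∈ Set.Icc 0 (c' * R ^ (2 + ρ)),
          ‖ODE.evolutionMap (fun _ : ℝ => selfSimilarTransport (1 / (2 + ρ)) 0 V') 0 (-σ) y‖ ≤ 2 * R})).toReal
      ≤ _ := hmono
    _ ≤ 1 / 2 * (volume (Metric.ball x₀ r)).toReal := hhalf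
    _ = (volume (Metric.ball x₀ r)).toReal / 2 := by ring

end LastExit

/-! ## The members -/

/-- **«SPIKES OR HOVERING» MEMBER (centred).**  An exactly self-similar member of the window class (`0 < ρ ≤ ½`, crux hypotheses verbatim) with a `C²` velocity
profile such that for EVERY classical pressure `P′` there are a vortical `x₀`, a level `h < ℋ_{P′}(x₀)`, NO FAR HOVERING above `h` and NO VORTICAL SPIKES above `h`
(exponent `θ < 2+ρ`) is trivial.  [folklore; ConstantinIgnatovaVicol2026Putative §3.4–§3.5] -/
theorem Loc.selfSimilar_ae_eq_zero_of_spikesOrHoveringC2_profile {ρ : ℝ} (hρ : 0 < ρ) (hρ1 : ρ ≤ 1 / 2)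
    {u : ℝ → EuclideanSpace ℝ (Fin 3) → EuclideanSpace ℝ (Fin 3)} {p : ℝ → EuclideanSpace ℝ (Fin 3) → ℝ}
    {H : ℝ → EuclideanSpace ℝ (Fin 3) → EuclideanSpace ℝ (Fin 3) →L[ℝ] EuclideanSpace ℝ (Fin 3)} {c : ℝ≥0}
    (hsw : IsSuitableWeakSolutionOn (slab (EuclideanSpace ℝ (Fin 3)) (Iio 0) isOpen_Iio) 0 0 u p)
    (hH : HasWeakSpatialGradientOn (slab (EuclideanSpace ℝ (Fin 3)) (Iio 0) isOpen_Iio) u H)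
    (hgauge : ∀ a : ℝ, 0 < a →
      ENNReal.ofReal (a ^ (2 * ρ)) * cknA a (0 : ℝ × EuclideanSpace ℝ (Fin 3)) u +
          ENNReal.ofReal (a ^ ρ) * cknE a (0 : ℝ × EuclideanSpace ℝ (Fin 3)) H +
        ENNReal.ofReal (a ^ (2 * ρ)) * cknD a (0 : ℝ × EuclideanSpace ℝ (Fin 3)) p ≤ (c : ℝ≥0∞))
    {V : EuclideanSpace ℝ (Fin 3) → EuclideanSpace ℝ (Fin 3)} {P : EuclideanSpace ℝ (Fin 3) → ℝ}
    (hu : ∀ τ : ℝ, τ < 0 → u τ = selfSimilarCollapse (1 / (2 + ρ)) 0 V τ)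
    (hp : ∀ τ : ℝ, τ < 0 → p τ = selfSimilarCollapsePressure (1 / (2 + ρ)) 0 P τ)
    (hV : ContDiff ℝ 2 V)
    (hB : ∀ P' : EuclideanSpace ℝ (Fin 3) → ℝ, IsSelfSimilarEulerProfile (1 / (2 + ρ)) 0 V P' →
      ∃ x₀ : EuclideanSpace ℝ (Fin 3), curl V x₀ ≠ 0 ∧ ∃ h : ℝ, h < selfSimilarBernoulli (1 / (2 + ρ)) 0 V P' x₀ ∧
        (∃ w₀ R₁ : ℝ, 0 < w₀ ∧ ∀ y : EuclideanSpace ℝ (Fin 3), R₁ ≤ ‖y‖ →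
          h < selfSimilarBernoulli (1 / (2 + ρ)) 0 V P' y → curl V y ≠ 0 →
            w₀ ≤ ‖selfSimilarTransport (1 / (2 + ρ)) 0 V y‖) ∧
        ∃ C θ : ℝ, θ < 2 + ρ ∧ ∀ R : ℝ, 1 ≤ R → ∀ z : EuclideanSpace ℝ (Fin 3), ‖z‖ ≤ 2 * R → curl V z ≠ 0 →
          h < selfSimilarBernoulli (1 / (2 + ρ)) 0 V P' z →
            selfSimilarBernoulli (1 / (2 + ρ)) 0 V P' z ≤ h + C * R ^ θ) :
    uncurry u =ᵐ[volume.restrict (Iio (0 : ℝ) ×ˢ (univ : Set (EuclideanSpace ℝ (Fin 3))))] 0 := by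
  have hρ1' : ρ < 1 := by linarith
  -- ### a classical pressure for the profile (as in `Loc.selfSimilar_ae_eq_zero_of_invariantBandDeficitC2_profile`)
  have hD : ∀ a : ℝ, 0 < a → ENNReal.ofReal (a ^ (2 * ρ)) *
      cknD a (0 : ℝ × EuclideanSpace ℝ (Fin 3)) p ≤ (c : ℝ≥0∞) :=
    fun a ha => le_trans le_add_self (hgauge a ha)
  have hpm : AEStronglyMeasurable (uncurry p)
      (volume.restrict (Iio (0 : ℝ) ×ˢ (univ : Set (EuclideanSpace ℝ (Fin 3))))) := by
    have := hsw.distributional.2.2.1.aestronglyMeasurable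
    simpa [slab] using this
  have hPm := aestronglyMeasurable_pressureProfile hpm hp
  have hDprof := profile_pressure_weight_of_gaugeD hρ hρ1' hpm hp hD
  have hP1 : LocallyIntegrable P volume :=
    EnergySaturation.locallyIntegrable_pressure_of_weight hρ1' hPm
      (ENNReal.mul_ne_top ENNReal.ofReal_ne_top ENNReal.coe_ne_top) hDprof
  obtain ⟨P', hprof⟩ :=
    WeakToClassical.exists_isSelfSimilarEulerProfile_of_contDiff hsw.distributional hu hp hV hP1
  -- ### the data and the clock
  obtain ⟨x₀, hx₀, h, hhx₀, ⟨w₀, R₁, hw₀, hNFH⟩, C, θ, hθe, hNS⟩ := hB P' hprof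
  have hclock := LastExit.localPowerClock_of_spikesOrHovering ρ hρ hρ1 V P' hV hprof h w₀ R₁ hw₀ hNFH C θ hθe hNS x₀ hx₀ hhx₀
  -- ### «one clocked ball kills»
  exact NeedleRace.selfSimilar_ae_eq_zero_of_localPowerClockC2 hρ hρ1 hsw hH hgauge hu hp hV hclock

namespace Past

variable {ρ T T₁ : ℝ}
  {u : ℝ → EuclideanSpace ℝ (Fin 3) → EuclideanSpace ℝ (Fin 3)} {p : ℝ → EuclideanSpace ℝ (Fin 3) → ℝ}
  {H : ℝ → EuclideanSpace ℝ (Fin 3) → EuclideanSpace ℝ (Fin 3) →L[ℝ] EuclideanSpace ℝ (Fin 3)} {c : ℝ≥0}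
  {V : EuclideanSpace ℝ (Fin 3) → EuclideanSpace ℝ (Fin 3)} {P : EuclideanSpace ℝ (Fin 3) → ℝ}

/-- **«SPIKES OR HOVERING» MEMBER (past-exact about `(T, x₀)`).**  Crux hypotheses verbatim, `0 < ρ ≤ ½`, exact self-similarity about `(T, x₀)` for
`τ < T₁`, `T₁ ≤ 0`, `T₁ ≤ T`, `V ∈ C²`, and the «spikes or hovering» data for every classical pressure ⇒ trivial.
[folklore; ConstantinIgnatovaVicol2026Putative §3.4–§3.5] -/
theorem selfSimilar_ae_eq_zero_of_spikesOrHoveringC2_profile_past (hρ : 0 < ρ) (hρh : ρ ≤ 1 / 2) (hT₁ : T₁ ≤ 0)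
    (hTT₁ : T₁ ≤ T) (x₀ : EuclideanSpace ℝ (Fin 3))
    (hsw : IsSuitableWeakSolutionOn (slab (EuclideanSpace ℝ (Fin 3)) (Iio 0) isOpen_Iio) 0 0 u p)
    (hH : HasWeakSpatialGradientOn (slab (EuclideanSpace ℝ (Fin 3)) (Iio 0) isOpen_Iio) u H)
    (hgauge : ∀ a : ℝ, 0 < a →
      ENNReal.ofReal (a ^ (2 * ρ)) * cknA a (0 : ℝ × EuclideanSpace ℝ (Fin 3)) u +
          ENNReal.ofReal (a ^ ρ) * cknE a (0 : ℝ × EuclideanSpace ℝ (Fin 3)) H +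
        ENNReal.ofReal (a ^ (2 * ρ)) * cknD a (0 : ℝ × EuclideanSpace ℝ (Fin 3)) p ≤ (c : ℝ≥0∞))
    (hu : ∀ τ : ℝ, τ < T₁ → u τ = fun x => selfSimilarCollapse (1 / (2 + ρ)) T V τ (x - x₀))
    (hp : ∀ τ : ℝ, τ < T₁ → p τ = fun x => selfSimilarCollapsePressure (1 / (2 + ρ)) T P τ (x - x₀))
    (hV : ContDiff ℝ 2 V)
    (hB : ∀ P' : EuclideanSpace ℝ (Fin 3) → ℝ, IsSelfSimilarEulerProfile (1 / (2 + ρ)) 0 V P' →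
      ∃ x₁ : EuclideanSpace ℝ (Fin 3), curl V x₁ ≠ 0 ∧ ∃ h : ℝ, h < selfSimilarBernoulli (1 / (2 + ρ)) 0 V P' x₁ ∧
        (∃ w₀ R₁ : ℝ, 0 < w₀ ∧ ∀ y : EuclideanSpace ℝ (Fin 3), R₁ ≤ ‖y‖ →
          h < selfSimilarBernoulli (1 / (2 + ρ)) 0 V P' y → curl V y ≠ 0 →
            w₀ ≤ ‖selfSimilarTransport (1 / (2 + ρ)) 0 V y‖) ∧
        ∃ C θ : ℝ, θ < 2 + ρ ∧ ∀ R : ℝ, 1 ≤ R → ∀ z : EuclideanSpace ℝ (Fin 3), ‖z‖ ≤ 2 * R → curl V z ≠ 0 →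
          h < selfSimilarBernoulli (1 / (2 + ρ)) 0 V P' z →
            selfSimilarBernoulli (1 / (2 + ρ)) 0 V P' z ≤ h + C * R ^ θ) :
    uncurry u =ᵐ[volume.restrict (Iio (0 : ℝ) ×ˢ (univ : Set (EuclideanSpace ℝ (Fin 3))))] 0 := by
  -- ### a classical pressure for the profile (far-past extension)
  obtain ⟨P', hprof⟩ := exists_isSelfSimilarEulerProfile hρ hT₁ hTT₁ hsw.distributional hu hp hV
  obtain ⟨x₁, hx₁, h, hhx₁, ⟨w₀, R₁, hw₀, hNFH⟩, C, θ, hθe, hNS⟩ := hB P' hprof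
  have hclock := LastExit.localPowerClock_of_spikesOrHovering ρ hρ hρh V P' hV hprof h w₀ R₁ hw₀ hNFH C θ hθe hNS x₁ hx₁ hhx₁
  exact NeedleRace.selfSimilar_ae_eq_zero_of_localPowerClockC2_past hρ hρh hT₁ hTT₁ x₀ hsw hH hgauge hu hp hV hclock

end Past

end Summit.NavierStokesRegularity.NavierStokesRegularity.Theorems.PowerGaugeEulerLiouville

end
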